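import Summits.QuantumFields.GaugeBoot.Rows.GLYZc2D3HTab
import HarnessLib

/-!
# Gauge-boot: kernel check of the raw `H` class table, rows 89–180 (part 3/3)

Cell `pub-gaugeboot` (HOME `run/shared/lean/pub/pub-gaugeboot/`), seat lean1 (binding layer for rows C32–C33, C51–C60 = the certified
glyz-c2-rp-3D windows: label sets, class/witness tables, the reduction identity, soundness, per-β bindings).

HONEST FRAMING (page 1 of every file of this cell): certified bounds on lattice expectations at STATED coupling,
gauge group, dimension and torus size; NOT a mass gap, NOT a continuum limit, NOT a string tension, NOT large `N`.
The venture is explicitly NOT Yang–Mills-summit-bearing (barriers `FixedCouplingUltralocality`,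
`PerturbativeInvisibility`).

`hcanon_rows_<lo>_<hi> : ∀ i, lo ≤ i < hi → ∀ j ≥ i, HCanonOK i j`, each range one closed computation (`decide +kernel`);
assembled in `GLYZc2D3Canon`.
-/

noncomputable section

open Literature.MathematicalPhysics.QuantumFieldTheory

namespace Summit.QuantumFields.GaugeBoot

namespace GLYZc2D3

set_option maxHeartbeats 0 in
/-- Rows `89 ≤ i < 103` of the `H` class table canonicalise (1197 entries; closed computation checked by the kernel). -/
theorem hcanon_rows_89_103 : ∀ i : Fin 181, 89 ≤ i.val → i.val < 103 → ∀ j : Fin 181, i.val ≤ j.val → HCanonOK i j := by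
  decide +kernel

set_option maxHeartbeats 0 in
/-- Rows `103 ≤ i < 120` of the `H` class table canonicalise (1190 entries; closed computation checked by the kernel). -/
theorem hcanon_rows_103_120 : ∀ i : Fin 181, 103 ≤ i.val → i.val < 120 → ∀ j : Fin 181, i.val ≤ j.val → HCanonOK i j := by
  decide +kernel

set_option maxHeartbeats 0 in
/-- Rows `120 ≤ i < 143` of the `H` class table canonicalise (1150 entries; closed computation checked by the kernel). -/
theorem hcanon_rows_120_143 : ∀ i : Fin 181, 120 ≤ i.val → i.val < 143 → ∀ j : Fin 181, i.val ≤ j.val → HCanonOK i j := by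
  decide +kernel

set_option maxHeartbeats 0 in
/-- Rows `143 ≤ i < 181` of the `H` class table canonicalise (741 entries; closed computation checked by the kernel). -/
theorem hcanon_rows_143_181 : ∀ i : Fin 181, 143 ≤ i.val → i.val < 181 → ∀ j : Fin 181, i.val ≤ j.val → HCanonOK i j := by
  decide +kernel

end GLYZc2D3

end Summit.QuantumFields.GaugeBoot

end
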